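import Mathlib
import HarnessLib

/-!
# Three square roots with pairwise non-square ratios are linearly independent over `ℚ` (the arithmetic input of the trace test for towers of CM
# elliptic curves of distinct fields, `CorCM/MumfordTateRankTypeIVTimesTwoCMCurves`)

COR-CM (cell `pub-hodgecm2`, seat `b27` gen 50, count-neutral Mumford–Tate-rank ladder; theorems only, no definition, no named fact;
UNCONDITIONAL — nothing here uses or asserts HC_CM).  Folklore algebra, stated in the shape produced by the ladder's field hypotheses
(`d ≠ q²d'` for all rational `q`, from «no ring homomorphism `End⁰E' → End⁰A`», `HodgeTheory/RankOneCentreTimesCMCurveProductSpan`):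

* `forall_ne_sq_mul_symm` — `a ≠ s²b` for all `s` ⟹ `b ≠ s²a` for all `s`;
* `eq_zero_of_ratCast_mul_sqrt_add_eq_zero` — `p√a + q√b = 0` ⟹ `p = q = 0`;
* **`eq_zero_of_ratCast_mul_sqrt_add_add_eq_zero`** — `p√a + q√b + r√c = 0` ⟹ `p = q = r = 0` (square `p√a + q√b = −r√c`: if `pq ≠ 0` then
  `√(ab) ∈ ℚ`), and its complex form `…_complex` (the traces of Hodge operators live in `ℂ`).
In the ladder `a, b, c` are the discriminant parameters `d, d', d''` of three pairwise non-isomorphic imaginary quadratic fields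
`ℚ(√−d)`, `ℚ(√−d')`, `ℚ(√−d'')` (Moonen–Zarhin's «no embedding of `k` into the centre of `End⁰X`», Prop. (3.8), for two curves at once).

## References
* [MoonenZarhin1999LowDim] B. Moonen, Yu. G. Zarhin, *Hodge classes on abelian varieties of low dimension*, Math. Ann. 315 (1999), §3 Prop. (3.8)
  [corpus: paper:arxiv-math_9901113 p. 7]. [cite: MoonenZarhin1999LowDim, §3 Prop. (3.8)]
* [SilvermanAEC2009] J. H. Silverman, *The Arithmetic of Elliptic Curves*, III §9 Cor. 9.4 (CM fields of elliptic curves are imaginary quadratic).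
  [cite: SilvermanAEC2009, III.9 Cor. 9.4]
-/

noncomputable section

namespace Summit.HodgeConjecture.CorCM

/-- `a ≠ s²b` for all rational `s` ⟹ `b ≠ s²a` for all rational `s` (`b > 0`). [folklore] -/
theorem forall_ne_sq_mul_symm {a b : ℕ} (hb : 0 < b) (hab : ∀ s : ℚ, (a : ℚ) ≠ s ^ 2 * b) : ∀ s : ℚ, (b : ℚ) ≠ s ^ 2 * a := by
  intro s hs
  have hs0 : s ≠ 0 := by
    rintro rfl
    rw [zero_pow two_ne_zero, zero_mul] at hs
    exact (Nat.cast_ne_zero.2 hb.ne') hs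
  refine hab s⁻¹ ?_
  rw [hs]
  field_simp

/-- **`p√a + q√b = 0` in `ℝ` with `a ≠ s²b` for every rational `s` (`a, b > 0`) ⟹ `p = q = 0`.** [folklore] -/
theorem eq_zero_of_ratCast_mul_sqrt_add_eq_zero {a b : ℕ} (hb : 0 < b) (hab : ∀ s : ℚ, (a : ℚ) ≠ s ^ 2 * b)
    {p q : ℚ} (h : (p : ℝ) * Real.sqrt a + q * Real.sqrt b = 0) : p = 0 ∧ q = 0 := by
  have hsb : 0 < Real.sqrt b := Real.sqrt_pos.2 (Nat.cast_pos.2 hb)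
  have hsq : (p : ℝ) ^ 2 * a = (q : ℝ) ^ 2 * b := by
    have h1 : (p : ℝ) * Real.sqrt a = -(q * Real.sqrt b) := eq_neg_of_add_eq_zero_left h
    have h2 := congrArg (fun x : ℝ => x ^ 2) h1
    simp only [mul_pow, neg_pow_two, Real.sq_sqrt (Nat.cast_nonneg a), Real.sq_sqrt (Nat.cast_nonneg b)] at h2
    exact h2
  have hsqQ : (p : ℚ) ^ 2 * a = q ^ 2 * b := by exact_mod_cast hsq
  by_cases hp : p = 0
  · subst hp
    refine ⟨rfl, ?_⟩
    rw [Rat.cast_zero, zero_mul, zero_add] at h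
    rcases mul_eq_zero.1 h with hq | hq
    · exact_mod_cast hq
    · exact absurd hq hsb.ne'
  · exfalso
    refine hab (q / p) ?_
    field_simp
    linarith [hsqQ]

/-- **Three square roots with pairwise non-square ratios are `ℚ`-linearly independent**: `p√a + q√b + r√c = 0` in `ℝ` with
`a ≠ s²b`, `a ≠ s²c`, `b ≠ s²c` for all rational `s` (`a, b, c > 0`) ⟹ `p = q = r = 0` (square `p√a + q√b = −r√c`: if `pq ≠ 0` then
`√(ab) ∈ ℚ`). [folklore] -/
theorem eq_zero_of_ratCast_mul_sqrt_add_add_eq_zero {a b c : ℕ} (hb : 0 < b) (hc : 0 < c)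
    (hab : ∀ s : ℚ, (a : ℚ) ≠ s ^ 2 * b) (hac : ∀ s : ℚ, (a : ℚ) ≠ s ^ 2 * c) (hbc : ∀ s : ℚ, (b : ℚ) ≠ s ^ 2 * c)
    {p q r : ℚ} (h : (p : ℝ) * Real.sqrt a + q * Real.sqrt b + r * Real.sqrt c = 0) : p = 0 ∧ q = 0 ∧ r = 0 := by
  have h1 : (p : ℝ) * Real.sqrt a + q * Real.sqrt b = -(r * Real.sqrt c) := eq_neg_of_add_eq_zero_left h
  have h2 : (p : ℝ) ^ 2 * a + (q : ℝ) ^ 2 * b + 2 * p * q * (Real.sqrt a * Real.sqrt b) = (r : ℝ) ^ 2 * c := by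
    have h2 := congrArg (fun x : ℝ => x ^ 2) h1
    simp only [neg_pow_two, mul_pow, Real.sq_sqrt (Nat.cast_nonneg c)] at h2
    rw [← h2, add_sq, mul_pow, mul_pow, Real.sq_sqrt (Nat.cast_nonneg a), Real.sq_sqrt (Nat.cast_nonneg b)]
    ring
  by_cases hpq : p * q = 0
  · rcases mul_eq_zero.1 hpq with hp | hq
    · subst hp
      rw [Rat.cast_zero, zero_mul, zero_add] at h
      exact ⟨rfl, eq_zero_of_ratCast_mul_sqrt_add_eq_zero hc hbc h⟩
    · subst hq
      rw [Rat.cast_zero, zero_mul, add_zero] at h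
      obtain ⟨hp, hr⟩ := eq_zero_of_ratCast_mul_sqrt_add_eq_zero hc hac h
      exact ⟨hp, rfl, hr⟩
  · exfalso
    have hs : Real.sqrt a * Real.sqrt b = (((r ^ 2 * c - p ^ 2 * a - q ^ 2 * b) / (2 * p * q) : ℚ) : ℝ) := by
      have hpqR : ((2 * p * q : ℚ) : ℝ) ≠ 0 := by
        exact_mod_cast mul_ne_zero (mul_ne_zero two_ne_zero (by rintro rfl; exact hpq (zero_mul q)))
          (by rintro rfl; exact hpq (mul_zero p))
      rw [Rat.cast_div, eq_div_iff hpqR]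
      push_cast
      linarith [h2]
    set s : ℚ := (r ^ 2 * c - p ^ 2 * a - q ^ 2 * b) / (2 * p * q) with hsdef
    have hab' : (a : ℝ) * b = (s : ℝ) ^ 2 := by
      rw [← hs, mul_pow, Real.sq_sqrt (Nat.cast_nonneg a), Real.sq_sqrt (Nat.cast_nonneg b)]
    have habQ : (a : ℚ) * b = s ^ 2 := by exact_mod_cast hab'
    refine hab (s / b) ?_
    have hbQ : (b : ℚ) ≠ 0 := by exact_mod_cast hb.ne'
    field_simp
    linarith [habQ]

/-- The complex form: `p√a + q√b + r√c = 0` in `ℂ` (rational `p, q, r`, real square roots) ⟹ `p = q = r = 0`. [folklore] -/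
theorem eq_zero_of_ratCast_mul_sqrt_add_add_eq_zero_complex {a b c : ℕ} (hb : 0 < b) (hc : 0 < c)
    (hab : ∀ s : ℚ, (a : ℚ) ≠ s ^ 2 * b) (hac : ∀ s : ℚ, (a : ℚ) ≠ s ^ 2 * c) (hbc : ∀ s : ℚ, (b : ℚ) ≠ s ^ 2 * c)
    {p q r : ℚ} (h : (p : ℂ) * (Real.sqrt a : ℂ) + (q : ℂ) * (Real.sqrt b : ℂ) + (r : ℂ) * (Real.sqrt c : ℂ) = 0) :
    p = 0 ∧ q = 0 ∧ r = 0 := by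
  refine eq_zero_of_ratCast_mul_sqrt_add_add_eq_zero hb hc hab hac hbc (p := p) (q := q) (r := r) ?_
  have h' : (((p : ℝ) * Real.sqrt a + q * Real.sqrt b + r * Real.sqrt c : ℝ) : ℂ) = 0 := by
    push_cast
    rw [← h]
  exact_mod_cast h'

end Summit.HodgeConjecture.CorCM

end
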